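import Summits.BirchSwinnertonDyer.BirchSwinnertonDyer.Theorems.KolyvaginRankRigidityAtTwoSignedEigenCount
import Summits.BirchSwinnertonDyer.BirchSwinnertonDyer.Theorems.KolyvaginRankRigidityAtTwoSignedRefillAtKolyvaginPlace
import Summits.BirchSwinnertonDyer.BirchSwinnertonDyer.Theorems.KolyvaginRankRigidityAtTwoWalkStepSign
import Summits.BirchSwinnertonDyer.BirchSwinnertonDyer.Theorems.KolyvaginRankRigidityAtTwoSwapKummerEigenLinesOfIndexAtTwo
import HarnessLib

/-!
# Crux U1 `KolyvaginBoundedDefectAtTwo` (stmt-BirchSwinnertonDyer-28083), LINE 17 `kolyvagin_swap` —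
# the TRANSVERSE EIGEN-LINE AT A KOLYVAGIN PLACE WITHOUT DESCRIBING IT (toward the pen's v8.1 stub SRF `ShapeRefillAtTwo`):
# `#𝒯_v^{τ_* = s} ≤ 2^(k+1)`, and a transverse exact `s`-class of local order `≥ 2^(k−c+1)` absorbs every other one up to `2^c`

Width seat `bsd-line-krr2-p2` g18 (ONE READER on LINE 17); `--supports stmt-BirchSwinnertonDyer-28083` (helper). THEOREMS ONLY: nothing
here proves SRF, SWα⁗, U1, a rung or BSD. BSD is NOT proved.

## What (frame of `…SignedRefillAtKolyvaginPlace`: `𝓛 = 𝓕(c)`, a `τ`-fixed place `v ∣ ℓ ∣ c` of index `≥ k + 1`, Weil datum, Poitou–Tate family)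
* `natCard_transverse_inf_ker_le` — **`#(𝒯_v ∩ ker(τ_* − s)) ≤ 2^(k+1)`**: the abstract signed eigen-count
  `RegularRefill.natCard_inf_ker_eq_of_lagrangian_pair` (`#H_tr^{(s)} = #H_f^{(s)}` for the complementary Lagrangian pair `Kum_v ⊕ 𝒯_v` under
  `inv_v(· ∪ₑ ·)` and the involution `τ_*`) and the Kummer count `kummer_eigen_at_two_of_index` (Zhang's numerics only). No description of
  `𝒯_v` or of `τ_*` on it is used.
* `exists_zsmul_eq_zsmul_of_transverse_eigen` — if `x ∈ 𝒯_v` is an exact `s`-class with `2^(k−c) • x ≠ 0` (`c ≤ k`), then every exact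
  `s`-class `y ∈ 𝒯_v` has `2^c • y ∈ ℤ x` (`RegularRefill.forall_exists_zsmul_eq_of_natCard_le_of_nsmul_eq_zero`: `#𝒯_v^{(s)} ≤ 2^(k+1) ≤ 2^(m+c)`
  where `2^m = ord x ≥ 2^(k−c+1)`).
References (locators only; no cited FACT is declared): [cite: MazurRubin2004, §1.3, §4.1 Cor. 4.1.9] [cite: Jetchev2008, §3.2 (2), Prop. 4.2]
[cite: GrossLMS1991, §3 (3.3)–(3.4)] [cite: MilneADT2006, Ch. I, Cor. 2.3].
Design: no definitions; `K : Type`; axioms `propext`, `Classical.choice`, `Quot.sound`.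
-/

set_option autoImplicit false
-- the Theorems namespace of this sub repeats the summit name by design (D-0017 nested layout)
set_option linter.dupNamespace false

noncomputable section

open scoped Classical
open Function NumberField IsDedekindDomain WeierstrassCurve Field
open Literature.NumberTheory.EllipticCurves Literature.NumberTheory.EllipticCurves.Jetchev2008
open Literature.NumberTheory.GaloisRepresentations Literature.NumberTheory.GaloisCohomology
open Literature.NumberTheory.GaloisRepresentations.DiscreteGaloisModule (localTatePairingZMod tateDual
  transverseSubgroup SelmerStructure)
open Literature.NumberTheory.Automorphic
open Summit.BirchSwinnertonDyer.Rank1Residual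
open Summit.BirchSwinnertonDyer.Rank1Residual.JET.RingClassTransverse
open Summit.BirchSwinnertonDyer.Rank1Residual.JET.SelmerVocabulary
open Summit.BirchSwinnertonDyer.Rank1Residual.X11b.Relaxation (invWeilPairing invWeilPairing_apply
  invWeilPairing_eq_zero_of_mem)
open Summit.BirchSwinnertonDyer.BirchSwinnertonDyer.Theorems.KolyvaginLowerBoundAtTwo

namespace Summit.BirchSwinnertonDyer.BirchSwinnertonDyer.Theorems.KolyvaginAtTwo.RegularRefill

variable {K : Type} [Field K] [NumberField K] (W : WeierstrassCurve ℚ) [W.IsElliptic] [W.IsGloballyMinimal]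
  (k : ℕ)
  (e : geomTorsion (W.baseChange K) ((2 ^ k : ℕ) : ℤ) → geomTorsion (W.baseChange K) ((2 ^ k : ℕ) : ℤ) →
    AlgebraicClosure K)
  (hμ : ∀ S T, e S T ^ (2 ^ k) = 1)
  (hadd₁ : ∀ S₁ S₂ T, e (S₁ + S₂) T = e S₁ T * e S₂ T)
  (hadd₂ : ∀ S T₁ T₂, e S (T₁ + T₂) = e S T₁ * e S T₂)
  (hgal : ∀ (g : absoluteGaloisGroup K) (S T : geomTorsion (W.baseChange K) ((2 ^ k : ℕ) : ℤ)),
    g • e S T = e (g • S) (g • T))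
  (halt : ∀ T, e T T = 1) (hnondeg : ∀ T, (∀ S, e S T = 1) → T = 0)
  (inv : LocalInvariants K (2 ^ k))
  (hK : IsImaginaryQuadratic K) (hD : NumberField.discr K < -4) (ι : K →+* ℂ)
  [∀ j : ℕ, NumberField (ringClassField K ι j)] (hk : 1 ≤ k)
  (c : ℕ) (hc : Squarefree c)
  (hkol : ∀ ℓ ∈ c.primeFactors, Zhang2014.IsKolyvaginPrime (W.conductorNorm ℤ) W K 2 ℓ)
  (hkM : ∀ ℓ ∈ c.primeFactors, k + 1 ≤ Zhang2014.kolyvaginIndex W 2 ℓ)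
  (𝒯 : SelmerStructure ((W.baseChange K).torsionGaloisModule ((2 ^ k : ℕ) : ℤ)))
  (h𝒯 : ∀ v : HeightOneSpectrum (𝓞 K), 𝒯 (Sum.inr v) =
    ⨅ ℓ ∈ c.primeFactors.filter (fun ℓ : ℕ ↦ ((ℓ : ℕ) : 𝓞 K) ∈ v.asIdeal),
      ⨅ (w' : HeightOneSpectrum (𝓞 (ringClassField K ι ℓ))) (_ : w'.asIdeal.LiesOver v.asIdeal),
        letI := (adicCompletionOfLiesOver K (ringClassField K ι ℓ) v w').toAlgebra
        transverseSubgroup (GaloisRep.toLocal v ((W.baseChange K).torsionGaloisModule ((2 ^ k : ℕ) : ℤ)))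
          (w'.adicCompletion (ringClassField K ι ℓ)))
  (hperf : inv.IsPerfect) (hvan : inv.SumLocalTermEqZero) (hcomp : inv.SelmerComplement)
  {ℓ : ℕ} (hℓc : ℓ ∈ c.primeFactors)
  (v : HeightOneSpectrum (𝓞 K)) (hv : (ℓ : 𝓞 K) ∈ v.asIdeal)
  {τ : K ≃ₐ[ℚ] K} (hτ1 : τ ≠ 1) (hfix : τ • v = v) {s : ℤ} (hs : s = 1 ∨ s = -1)
  (hτe : ∀ S T, liftAutPlace τ hfix (e S T) =
    e ((isLiftOfAut_liftAutPlace τ hfix).torsionMap W (2 ^ k) S) ((isLiftOfAut_liftAutPlace τ hfix).torsionMap W (2 ^ k) T))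
  (hinvc : inv.IsConjCompatible τ)

/-! ### §1 The count of the transverse `s`-eigen-part -/

include hμ hadd₁ hadd₂ hgal halt hnondeg hK hD hk hc hkol hkM h𝒯 hperf hℓc hv hτ1 hs hτe hinvc in
/-- **`#(𝒯_v ∩ ker(τ_* − s)) ≤ 2^(k+1)`** at a Kolyvagin place of index `≥ k + 1` (see the module docstring).
[cite: MazurRubin2004, §1.3] [cite: Jetchev2008, §3.2 (2), Prop. 4.2] -/
theorem natCard_transverse_inf_ker_le [NeZero (2 ^ k)] [Finite (geomTorsion (W.baseChange K) ((2 ^ k : ℕ) : ℤ))] :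
    Nat.card ↥(𝒯 (Sum.inr v) ⊓ (conjActPlace W τ ((2 ^ k : ℕ) : ℤ) hfix - s • AddMonoidHom.id _).ker) ≤ 2 ^ (k + 1) := by
  haveI : Finite (galoisCohomology ((((W.baseChange K).torsionGaloisModule ((2 ^ k : ℕ) : ℤ))).toLocal
      (Sum.inr v : Place K)) 1) := finite_galoisCohomology_one_toLocal _ v
  haveI : ∀ w : Place K, CompactSpace (absoluteGaloisGroup (Place.Completion w)) :=
    fun w ↦ absoluteGaloisGroup_compactSpace _
  have hinv : Injective (inv (Sum.inr v)) := (hperf v).1.1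
  have hvc : v ∈ placesDividing K c := mem_placesDividing_of_mem_primeFactors hc hℓc v hv
  have hττ : τ * τ = 1 := by
    haveI : Algebra.IsQuadraticExtension ℚ K := ⟨hK.1⟩
    have hcard : Nat.card (K ≃ₐ[ℚ] K) = 2 := by rw [IsGalois.card_aut_eq_finrank, hK.1]
    haveI : Finite (K ≃ₐ[ℚ] K) := Nat.finite_of_card_ne_zero (by rw [hcard]; decide)
    have h : τ ^ Nat.card (K ≃ₐ[ℚ] K) = 1 := pow_card_eq_one'
    rw [hcard, pow_two] at h
    exact h
  have hcount := (kummer_eigen_at_two_of_index W K hK hk (hkol ℓ hℓc) (hkM ℓ hℓc) v hv hτ1 hfix hs).1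
  rw [natCard_inf_ker_eq_of_lagrangian_pair
    (invWeilPairing (W.baseChange K) (2 ^ k) e hμ hadd₁ hadd₂ hgal inv (Sum.inr v))
    (X11b.KummerPT.nsmul_galoisCohomology_toLocal_eq_zero (W.baseChange K) (2 ^ k) (Sum.inr v))
    (fun x y ↦ AdditiveKoly.LagrangianSwitchAtP.invWeilPairing_symm (W.baseChange K) (2 ^ k) e hμ hadd₁ hadd₂ hgal
      halt inv (Sum.inr v) x y)
    (kummer_sup_transverse_eq_top_two W k hK hD ι hk c hc hkol hkM 𝒯 h𝒯 v hvc)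
    (fun x hx y hy ↦ invWeilPairing_eq_zero_of_mem (W.baseChange K) (2 ^ k) e hμ hadd₁ hadd₂ hgal halt inv
      (Sum.inr v) hx hy)
    (fun x hx y hy ↦ transverse_isotropic_two W k e hμ hadd₁ hadd₂ hgal halt hnondeg inv hK hD ι hk c hc hkol hkM 𝒯
      h𝒯 hperf v hvc hx hy)
    (conjActPlace W τ ((2 ^ k : ℕ) : ℤ) hfix) (fun x ↦ conjActPlace_conjActPlace W τ ((2 ^ k : ℕ) : ℤ) hττ hfix hfix x)
    (fun x y ↦ invWeilPairing_conjActPlace W τ (2 ^ k) e hμ hadd₁ hadd₂ hgal inv hinvc hfix hτe x y)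
    (fun f hf ↦ conjActPlace_mem_kummerSelmerStructure W τ ((2 ^ k : ℕ) : ℤ) hfix hf)
    (fun x hx ↦ JET.forall_conjActPlace_mem_of_eq_iInf_transverseSubgroup W hK ι τ ((2 ^ k : ℕ) : ℤ) c 𝒯 h𝒯 v v
      hfix hvc x hx)
    (invWeilPairing_injective_of_symm W k e hμ hadd₁ hadd₂ hgal halt hnondeg inv v hinv) s]
  exact hcount

/-! ### §2 A big transverse eigenclass absorbs the others -/

include hμ hadd₁ hadd₂ hgal halt hnondeg hK hD hk hc hkol hkM h𝒯 hperf hℓc hv hτ1 hs hτe hinvc in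
/-- **Absorption in the transverse `s`-eigen-part.** If `x ∈ 𝒯_v` with `τ_* x = s • x` has `2^(k−c) • x ≠ 0` (`c ≤ k`), then every
`y ∈ 𝒯_v` with `τ_* y = s • y` satisfies `2^c • y = t • x` for some `t : ℤ`. [cite: MazurRubin2004, §4.1 Cor. 4.1.9] -/
theorem exists_zsmul_eq_zsmul_of_transverse_eigen [NeZero (2 ^ k)] [Finite (geomTorsion (W.baseChange K) ((2 ^ k : ℕ) : ℤ))]
    {c₀ : ℕ} (hc₀ : c₀ ≤ k)
    {x : galoisCohomology ((((W.baseChange K).torsionGaloisModule ((2 ^ k : ℕ) : ℤ))).toLocal (Sum.inr v : Place K)) 1}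
    (hxT : x ∈ 𝒯 (Sum.inr v)) (hxeig : conjActPlace W τ ((2 ^ k : ℕ) : ℤ) hfix x = s • x)
    (hxne : (2 : ℤ) ^ (k - c₀) • x ≠ 0)
    {y : galoisCohomology ((((W.baseChange K).torsionGaloisModule ((2 ^ k : ℕ) : ℤ))).toLocal (Sum.inr v : Place K)) 1}
    (hyT : y ∈ 𝒯 (Sum.inr v)) (hyeig : conjActPlace W τ ((2 ^ k : ℕ) : ℤ) hfix y = s • y) :
    ∃ t : ℤ, (2 : ℤ) ^ c₀ • y = t • x := by
  haveI : Finite (galoisCohomology ((((W.baseChange K).torsionGaloisModule ((2 ^ k : ℕ) : ℤ))).toLocal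
      (Sum.inr v : Place K)) 1) := finite_galoisCohomology_one_toLocal _ v
  set E : AddSubgroup (galoisCohomology ((((W.baseChange K).torsionGaloisModule ((2 ^ k : ℕ) : ℤ))).toLocal
      (Sum.inr v : Place K)) 1) := 𝒯 (Sum.inr v) ⊓ (conjActPlace W τ ((2 ^ k : ℕ) : ℤ) hfix - s • AddMonoidHom.id _).ker with hE
  have hmemE : ∀ {z}, z ∈ E ↔ z ∈ 𝒯 (Sum.inr v) ∧ conjActPlace W τ ((2 ^ k : ℕ) : ℤ) hfix z = s • z := fun {z} ↦ by
    rw [hE, AddSubgroup.mem_inf, AddMonoidHom.mem_ker, AddMonoidHom.sub_apply, AddMonoidHom.smul_apply,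
      AddMonoidHom.id_apply, sub_eq_zero]
  have hexp : ∀ z : galoisCohomology ((((W.baseChange K).torsionGaloisModule ((2 ^ k : ℕ) : ℤ))).toLocal
      (Sum.inr v : Place K)) 1, (2 ^ k) • z = 0 := fun z ↦
    X11b.KummerPT.nsmul_galoisCohomology_toLocal_eq_zero (W.baseChange K) (2 ^ k) (Sum.inr v) z
  -- `ord x = 2^m` with `k - c₀ + 1 ≤ m`
  obtain ⟨m, -, hm⟩ := (Nat.dvd_prime_pow Nat.prime_two).mp (addOrderOf_dvd_of_nsmul_eq_zero (hexp x))
  have hmc : k - c₀ + 1 ≤ m := by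
    have hk2 : (2 : ℤ) ^ k • x = 0 := by
      rw [show ((2 : ℤ) ^ k) = ((2 ^ k : ℕ) : ℤ) by rw [Nat.cast_pow, Nat.cast_ofNat], natCast_zsmul]; exact hexp x
    have h := two_pow_dvd_of_zsmul_eq_zero_of_ne_zero hk2 hxne (b := (2 : ℤ) ^ m)
      (by rw [show ((2 : ℤ) ^ m) = ((2 ^ m : ℕ) : ℤ) by rw [Nat.cast_pow, Nat.cast_ofNat], natCast_zsmul, ← hm];
          exact addOrderOf_nsmul_eq_zero x)
    have h' : 2 ^ (k - c₀ + 1) ∣ 2 ^ m := by exact_mod_cast h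
    exact (Nat.pow_dvd_pow_iff_le_right one_lt_two).mp h'
  have hcard : Nat.card E ≤ 2 ^ (m + c₀) :=
    (natCard_transverse_inf_ker_le W k e hμ hadd₁ hadd₂ hgal halt hnondeg inv hK hD ι hk c hc hkol hkM 𝒯 h𝒯 hperf hℓc v hv
      hτ1 hfix hs hτe hinvc).trans (Nat.pow_le_pow_right (by norm_num) (by omega))
  obtain ⟨t, ht⟩ := forall_exists_zsmul_eq_of_natCard_le_of_nsmul_eq_zero E k m c₀ (fun z _ ↦ hexp z)
    (hmemE.mpr ⟨hxT, hxeig⟩) hm hcard y (hmemE.mpr ⟨hyT, hyeig⟩)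
  refine ⟨t, ?_⟩
  rw [show ((2 : ℤ) ^ c₀) = ((2 ^ c₀ : ℕ) : ℤ) by rw [Nat.cast_pow, Nat.cast_ofNat]]
  exact ht

end Summit.BirchSwinnertonDyer.BirchSwinnertonDyer.Theorems.KolyvaginAtTwo.RegularRefill

end
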